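import Mathlib
import Summits.ResolutionOfSingularities.ResolutionOfSingularities.Theorems.WeightedInvariantLocalWeightedDropTOT2BudgetBasics
import Summits.ResolutionOfSingularities.ResolutionOfSingularities.Theorems.WeightedInvariantLocalWeightedDropNCBranchPrimesReading
import Summits.ResolutionOfSingularities.ResolutionOfSingularities.Theorems.WeightedInvariantLocalWeightedDropPolyDescentMinimality
import Summits.ResolutionOfSingularities.ResolutionOfSingularities.Theorems.WeightedInvariantLocalWeightedDropPolyDescentRegimeRank

/-!
# TOT2-LINE (P3) brick B5-D (part 2): THE CONFLICT BRANCH — well-prepared minimality for `Perm2`, the prime of a graph datum EXPLICITLY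
# (kernel description, principal maximal ideal, value `1` on `u₁`), and D5 `exists_transverse_of_conflict`

Sub-problem `ResolutionOfSingularities`, ENGINE crux `stmt-ResolutionOfSingularities-8899` (`LocalWeightedDrop`), skeleton v35 (2e806da509994632),
registered stub `stub_conflictBudget` (P3); typed split `L/res-L1-w43-stub-2/g6/P3_split_v1.lean` (7fbb6274b2c57d05), brick B5-D5 VERBATIM.
[OURS · L1 W4.3 · chain w43 · res-L1-w43-stub-2 g6 (owner of (P3)); def-free; re-runs stub-1's reading `NCBranchPrimes.exists_prime_of_graphDatum`
with the kernel exposed, over the lead's `stub_polyMinimality` and B2/B6-basics; nothing here is a statement of any manuscript; AI-produced,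
gate-checked, weaker than expert review.]

* `isPermissibleTwoT_of_shift` (design v1 (D5)'s «h ≠ 0» input) — for a WELL-PREPARED position, if some re-centring `y ↦ y + ψ` makes `V(y,u₂)`
  permissible then it already is (`stub_polyMinimality` with the weight `(1, M)`, `M ≫ 0`);
* `exists_graphPrime` — the prime `P = ker (κ ∘ σ_{h,ψ})` of a graph datum with: prime, `u₁ ∉ P`, `u₂ − u₁h ∈ P`, `F ∈ P^d`, every `f` congruent mod
  `P` to a `u₂`-free plane series, hence **`maximalIdeal (R₃ ⧸ P) = (ū₁)`** — the branch ring is a discrete valuation ring with uniformizer `ū₁`;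
* `branchVal_X_zero_eq_one_of_principal` — a one-dimensional top-locus prime whose branch ring has maximal ideal `(ū₁)` has `v_P(u₁) = 1`
  (the branch ring is its own normalisation);
* **`exists_transverse_of_conflict`** (D5) — under the context, `InPoly` and `Conflict`: some NON-LINE top-locus prime has `v_P(u₁) = 1`.
-/

set_option linter.dupNamespace false -- mandated namespace of this single-conjunct summit

noncomputable section

namespace Summit.ResolutionOfSingularities.ResolutionOfSingularities.Theorems

namespace TOT2Branch

open MvPowerSeries IsLocalRing PolyDescent MonicDescent WildMonic Literature.AlgebraicGeometry.Resolution

variable {k : Type} [Field k]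

/-! ## Well-prepared minimality for `Perm2` -/

/-- **A re-centring cannot create `V(y,u₂)`-permissibility on a well-prepared position**: if `V(y,u₂)` is permissible for `shift d A ψ`
(`ψ(0) = 0`) then it is permissible for `A` (Hironaka's vertex theorem in the tree's form `stub_polyMinimality`, read with the weight `(1, M)`). -/
theorem isPermissibleTwoT_of_shift {d : ℕ} (hd : 0 < d) {A : Fin d → MvPowerSeries (Fin 2) k} (hWP : WellPrepared d A) (hpos : IsPosT d A)
    {ψ : MvPowerSeries (Fin 2) k} (hψ : constantCoeff ψ = 0) (h2 : IsPermissibleTwoT d (shift d A ψ)) : IsPermissibleTwoT d A := by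
  intro j e he
  by_contra hlt
  push Not at hlt
  -- the Newton point of the offending coefficient
  set P : Fin 2 →₀ ℕ := slotWeight d j • e with hPdef
  have hP : P ∈ newtonSet A := ⟨j, e, he, rfl⟩
  have hP1 : P 1 + slotWeight d j ≤ d.factorial := by
    have h1 : P 1 = slotWeight d j * e 1 := by simp [hPdef]
    rw [h1, ← slotWeight_mul_sub j]
    have : slotWeight d j * e 1 + slotWeight d j = slotWeight d j * (e 1 + 1) := by ring
    rw [this]
    exact Nat.mul_le_mul_left _ (by omega)
  have hsw := slotWeight_pos (d := d) j
  -- the weight `(1, M)` with `M = P 0 + 1`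
  let w : Fin 2 → ℕ := ![1, P 0 + 1]
  have hw : ∀ i, 0 < w i := by intro i; fin_cases i <;> simp [w]
  obtain ⟨Q, hQ, hQP⟩ := stub_polyMinimality k d hd A ψ hWP hpos hψ w hw P hP
  -- every Newton point of the shifted label has `Q 1 ≥ d!`
  obtain ⟨j', e', he', rfl⟩ := hQ
  have hQ1 : d.factorial ≤ (slotWeight d j' • e') 1 := by
    have := h2 j' e' he'
    have h1 : (slotWeight d j' • e') 1 = slotWeight d j' * e' 1 := by simp
    rw [h1, ← slotWeight_mul_sub j']
    exact Nat.mul_le_mul_left _ this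
  -- compare the weights
  have hw0 : w 0 = 1 := rfl
  have hw1 : w 1 = P 0 + 1 := rfl
  rw [weight_fin_two, weight_fin_two, hw0, hw1] at hQP
  -- `hQP : 1 * Q 0 + (P 0 + 1) * Q 1 ≤ 1 * P 0 + (P 0 + 1) * P 1` with `Q 1 ≥ d!` and `P 1 + 1 ≤ d!`
  have h4 : P 1 + 1 ≤ d.factorial := by omega
  have h5 : (P 0 + 1) * d.factorial ≤ (P 0 + 1) * (slotWeight d j' • e') 1 := Nat.mul_le_mul_left _ hQ1
  have h6 : (P 0 + 1) * (P 1 + 1) ≤ (P 0 + 1) * d.factorial := Nat.mul_le_mul_left _ h4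
  nlinarith

/-! ## The prime of a graph datum, explicitly -/

/-- Plane series restricted to `u₂ = 0` and read back in three variables: `(u₁,u₂,y) ↦ (u₁,0,0)` on `k⟦u₁,u₂,y⟧` agrees on `toThree g` with the
embedded `u₂`-free part of `g`. -/
theorem toThree_killTwo_eq_killThree (F : MvPowerSeries (Fin 3) k) :
    toThree (subst (![X 0, 0, 0] : Fin 3 → MvPowerSeries (Fin 2) k) F) = subst (![X 0, 0, 0] : Fin 3 → MvPowerSeries (Fin 3) k) F := by
  have ha : ∀ i, constantCoeff ((![X 0, 0, 0] : Fin 3 → MvPowerSeries (Fin 2) k) i) = 0 := by intro i; fin_cases i <;> simp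
  rw [toThree, rename_subst_eq _ _ ha]
  congr 1
  funext i
  fin_cases i <;> simp [rename_X]

/-- The two-variable kill `(u₁,u₂,y) ↦ (u₁,0,0) ∈ k⟦u₁,u₂⟧` produces `u₂`-free series. -/
theorem noY_killThreeToTwo (F : MvPowerSeries (Fin 3) k) :
    ∀ e : Fin 2 →₀ ℕ, e 1 ≠ 0 → coeff e (subst (![X 0, 0, 0] : Fin 3 → MvPowerSeries (Fin 2) k) F) = 0 := by
  intro e he
  have ha : ∀ i, constantCoeff ((![X 0, 0, 0] : Fin 3 → MvPowerSeries (Fin 2) k) i) = 0 := by intro i; fin_cases i <;> simp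
  have hkill : subst (![X 0, 0] : Fin 2 → MvPowerSeries (Fin 2) k) (subst (![X 0, 0, 0] : Fin 3 → MvPowerSeries (Fin 2) k) F) =
      subst (![X 0, 0, 0] : Fin 3 → MvPowerSeries (Fin 2) k) F := by
    rw [subst_comp_subst_apply (hasSubst_of_constantCoeff_zero ha) TOT2Curve.hasSubst_killTwo]
    congr 1
    funext i
    fin_cases i
    · show subst ![X 0, 0] (X 0 : MvPowerSeries (Fin 2) k) = X 0
      rw [subst_X TOT2Curve.hasSubst_killTwo]; rfl
    · show subst ![X 0, 0] (0 : MvPowerSeries (Fin 2) k) = 0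
      rw [← coe_substAlgHom TOT2Curve.hasSubst_killTwo, map_zero]
    · show subst ![X 0, 0] (0 : MvPowerSeries (Fin 2) k) = 0
      rw [← coe_substAlgHom TOT2Curve.hasSubst_killTwo, map_zero]
  rw [← hkill, TOT2Curve.coeff_subst_killTwo, if_neg he]

/-- A `u₂`-free plane series with zero constant term is divisible by `u₁`. -/
theorem X_zero_dvd_of_noY {g : MvPowerSeries (Fin 2) k} (hg : ∀ e : Fin 2 →₀ ℕ, e 1 ≠ 0 → coeff e g = 0) (h0 : constantCoeff g = 0) :
    (X 0 : MvPowerSeries (Fin 2) k) ∣ g := by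
  rw [X_dvd_iff]
  intro e he
  by_cases he1 : e 1 = 0
  · have : e = 0 := by ext i; fin_cases i <;> simp [he, he1]
    rw [this, coeff_zero_eq_constantCoeff]
    exact h0
  · exact hg e he1

/-- **THE PRIME OF A GRAPH DATUM, EXPLICITLY.**  For a `u₂`-free `h`, `ψ(0) = 0` and `V(y,u₂)` permissible for `shift d (shearT h A) ψ`:
a prime `P` with `u₁ ∉ P`, `u₂ − u₁h ∈ P`, `monicGerm d A ∈ P^d`, and EVERY `f` congruent modulo `P` to the embedding of a `u₂`-free plane series
(namely of `f(u₁, u₂+u₁h, y+ψ)|_{u₂=y=0}`), which is moreover FIXED: `u₂`-free plane series `g` satisfy `toThree g ∈ P → g = 0`. -/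
theorem exists_graphPrime {d : ℕ} (A : Fin d → MvPowerSeries (Fin 2) k) {h ψ : MvPowerSeries (Fin 2) k}
    (hh : ∀ e : Fin 2 →₀ ℕ, e 1 ≠ 0 → coeff e h = 0) (hψ : constantCoeff ψ = 0) (hperm : IsPermissibleTwoT d (shift d (shearT h A) ψ)) :
    ∃ P : Ideal (MvPowerSeries (Fin 3) k), P.IsPrime ∧ (X 0 : MvPowerSeries (Fin 3) k) ∉ P ∧
      (X 1 - X 0 * toThree h : MvPowerSeries (Fin 3) k) ∈ P ∧ NCPoly.monicGerm d A ∈ P ^ d ∧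
      (∀ g : MvPowerSeries (Fin 2) k, (∀ e : Fin 2 →₀ ℕ, e 1 ≠ 0 → coeff e g = 0) → toThree g ∈ P → g = 0) ∧
      (∀ f : MvPowerSeries (Fin 3) k, ∃ g : MvPowerSeries (Fin 2) k, (∀ e : Fin 2 →₀ ℕ, e 1 ≠ 0 → coeff e g = 0) ∧ f - toThree g ∈ P) := by
  have hS1 : HasSubst (shear3 h) := hasSubst_of_constantCoeff_zero (constantCoeff_shear3 h)
  have hS2 : HasSubst (NCPoly.recentre ψ) := hasSubst_of_constantCoeff_zero (NCPoly.constantCoeff_recentre hψ)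
  set σ : MvPowerSeries (Fin 3) k →+* MvPowerSeries (Fin 3) k := (substAlgHom hS2).toRingHom.comp (substAlgHom hS1).toRingHom with hσdef
  have hσ : ∀ F, σ F = subst (NCPoly.recentre ψ) (subst (shear3 h) F) := by
    intro F
    rw [hσdef, RingHom.comp_apply]
    change (substAlgHom hS2) ((substAlgHom hS1) F) = _
    rw [coe_substAlgHom hS1, coe_substAlgHom hS2]
  set κ : MvPowerSeries (Fin 3) k →+* MvPowerSeries (Fin 3) k := (substAlgHom (NCBranchPrimes.hasSubst_killTwoThree (k := k))).toRingHom
    with hκdef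
  have hκ : ∀ F, κ F = subst (![X 0, 0, 0] : Fin 3 → MvPowerSeries (Fin 3) k) F := by
    intro F
    rw [hκdef]
    change (substAlgHom NCBranchPrimes.hasSubst_killTwoThree) F = _
    rw [coe_substAlgHom]
  -- values
  have hσX0 : σ (X 0) = X 0 := by
    rw [hσ, subst_X hS1, show shear3 h 0 = X 0 from rfl, subst_X hS2, NCPoly.recentre_of_ne ψ (by decide)]
  have hσh : subst (shear3 h) (toThree h) = toThree h := by
    rw [toThree, subst_shear3_rename, shear_eq_self_of_noY h h hh]
  have hσX1 : σ (X 1 - X 0 * toThree h) = X 1 := by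
    rw [hσ, ← coe_substAlgHom hS1, map_sub, map_mul, coe_substAlgHom hS1, subst_X hS1, subst_X hS1, hσh, toThree,
      show shear3 h 1 = X 1 + X 0 * rename (Fin.succAboveEmb (Fin.last 2)) h from rfl, show shear3 h 0 = X 0 from rfl, add_sub_cancel_right,
      subst_X hS2, NCPoly.recentre_of_ne ψ (by decide)]
  have hκX0 : κ (X 0) = X 0 := by rw [hκ, subst_X NCBranchPrimes.hasSubst_killTwoThree]; rfl
  have hκX1 : κ (X 1) = 0 := by rw [hκ, subst_X NCBranchPrimes.hasSubst_killTwoThree]; rfl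
  have hκX2 : κ (X (Fin.last 2)) = 0 := by rw [hκ, subst_X NCBranchPrimes.hasSubst_killTwoThree]; rfl
  -- `κ ∘ σ` fixes the `u₂`-free plane series
  have hfix : ∀ g : MvPowerSeries (Fin 2) k, (∀ e : Fin 2 →₀ ℕ, e 1 ≠ 0 → coeff e g = 0) → κ (σ (toThree g)) = toThree g := by
    intro g hg
    rw [hσ, toThree, subst_shear3_rename, shear_eq_self_of_noY h g hg, NCBranchPrimes.subst_recentre_rename hψ, hκ,
      NCBranchPrimes.subst_kill_rename, TOT2Curve.killTwo_of_noY g hg]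
  -- the image of `κ` consists of embedded `u₂`-free plane series
  have himage : ∀ F : MvPowerSeries (Fin 3) k, ∃ g : MvPowerSeries (Fin 2) k, (∀ e : Fin 2 →₀ ℕ, e 1 ≠ 0 → coeff e g = 0) ∧ κ F = toThree g :=
    fun F => ⟨_, noY_killThreeToTwo F, by rw [hκ, toThree_killTwo_eq_killThree]⟩
  -- two-sided inverse of `σ`
  obtain ⟨τ₁, hτ₁l, hτ₁r⟩ := NCBranchPrimes.exists_inverse_ringHom (constantCoeff_shear3 h) (by rw [det_linMat_shear3]; exact isUnit_one)
  obtain ⟨τ₂, hτ₂l, hτ₂r⟩ := NCBranchPrimes.exists_inverse_ringHom (NCPoly.constantCoeff_recentre hψ) (NCPoly.isUnit_det_linMat_recentre ψ)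
  have hτσ : ∀ x, (τ₁.comp τ₂) (σ x) = x := fun x => by rw [hσ, RingHom.comp_apply, hτ₂l, hτ₁l]
  have hστ : ∀ x, σ ((τ₁.comp τ₂) x) = x := fun x => by rw [hσ, RingHom.comp_apply, hτ₁r, hτ₂r]
  haveI : IsDomain (MvPowerSeries (Fin 3) k) := NoZeroDivisors.to_isDomain _
  refine ⟨RingHom.ker (κ.comp σ), RingHom.ker_isPrime _, ?_, ?_, ?_, ?_, ?_⟩
  · -- `u₁ ∉ P`
    intro h1
    rw [RingHom.mem_ker, RingHom.comp_apply, hσX0, hκX0] at h1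
    exact NCBranchPrimes.X_zero_ne_zero h1
  · -- `u₂ − u₁h ∈ P`
    rw [RingHom.mem_ker, RingHom.comp_apply, hσX1, hκX1]
  · -- `F ∈ P^d`
    refine NCBranchPrimes.mem_pow_of_inverse σ (τ₁.comp τ₂) hτσ (Q := RingHom.ker κ) (fun q hq => ?_) ?_
    · rw [RingHom.mem_ker, RingHom.comp_apply, hστ]
      exact hq
    · rw [hσ, NCBranchPrimes.subst_recentre_subst_shear3_monicGerm h hψ]
      exact NCBranchPrimes.monicGerm_mem_pow_of_isPermissibleTwoT hperm hκX1 hκX2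
  · -- `u₂`-free plane series in `P` vanish
    intro g hg hgP
    rw [RingHom.mem_ker, RingHom.comp_apply, hfix g hg] at hgP
    exact rename_injective (Fin.succAboveEmb (Fin.last 2)) (show rename _ g = rename _ 0 by rw [map_zero]; exact hgP)
  · -- every `f` is congruent to an embedded `u₂`-free plane series
    intro f
    obtain ⟨g, hg, hgf⟩ := himage (σ f)
    refine ⟨g, hg, ?_⟩
    rw [RingHom.mem_ker, map_sub, RingHom.comp_apply, hgf, RingHom.comp_apply, hfix g hg, sub_self]

/-- **The branch ring of a graph-datum prime has maximal ideal `(ū₁)`**: from «every class is the class of a `u₂`-free plane series» and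
«those in `P` vanish». -/
theorem maximalIdeal_quotient_eq_span {P : Ideal (MvPowerSeries (Fin 3) k)} [hP : P.IsPrime]
    (hcong : ∀ f : MvPowerSeries (Fin 3) k, ∃ g : MvPowerSeries (Fin 2) k, (∀ e : Fin 2 →₀ ℕ, e 1 ≠ 0 → coeff e g = 0) ∧ f - toThree g ∈ P) :
    haveI := isLocalRing_quotient P
    maximalIdeal (MvPowerSeries (Fin 3) k ⧸ P) = Ideal.span {Ideal.Quotient.mk P (X 0)} := by
  haveI := isLocalRing_quotient P
  apply le_antisymm
  · intro x hx
    obtain ⟨f, rfl⟩ := Ideal.Quotient.mk_surjective x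
    have hf : f ∈ maximalIdeal (MvPowerSeries (Fin 3) k) := by
      by_contra hfu
      exact hx ((isUnit_mk_iff P hP.ne_top f).mpr (not_not.mp fun h => hfu h))
    obtain ⟨g, hg, hfg⟩ := hcong f
    -- `g(0) = 0`
    have hg0 : constantCoeff g = 0 := by
      have h1 : f - toThree g ∈ maximalIdeal (MvPowerSeries (Fin 3) k) := IsLocalRing.le_maximalIdeal hP.ne_top hfg
      have h2 : toThree g ∈ maximalIdeal (MvPowerSeries (Fin 3) k) := by
        have := Ideal.sub_mem _ hf h1; rwa [sub_sub_cancel] at this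
      rw [IsLocalRing.mem_maximalIdeal, mem_nonunits_iff, MvPowerSeries.isUnit_iff_constantCoeff, toThree, constantCoeff_rename] at h2
      by_contra hne
      exact h2 (isUnit_iff_ne_zero.mpr hne)
    obtain ⟨g₁, hg₁⟩ := X_zero_dvd_of_noY hg hg0
    have hclass : Ideal.Quotient.mk P f = Ideal.Quotient.mk P (X 0) * Ideal.Quotient.mk P (toThree g₁) := by
      have htg : toThree g = X 0 * toThree g₁ := by rw [hg₁, map_mul, toThree_X]; rfl
      rw [← map_mul, Ideal.Quotient.eq]
      rw [htg] at hfg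
      exact hfg
    rw [hclass]
    exact Ideal.mul_mem_right _ _ (Ideal.subset_span rfl)
  · rw [Ideal.span_le, Set.singleton_subset_iff]
    rw [SetLike.mem_coe, ← IsLocalRing.map_maximalIdeal_of_surjective (Ideal.Quotient.mk P) Ideal.Quotient.mk_surjective]
    exact Ideal.mem_map_of_mem _ (X_mem_maximalIdeal k (Fin 3) 0)

/-- **A one-dimensional prime whose branch ring has maximal ideal `(ū₁)` has `v_P(u₁) = 1`**: the branch ring is a discrete valuation ring
with uniformizer `ū₁`, hence its own normalisation. -/
theorem addVal_mk_X_zero_eq_one_of_principal (P : Ideal (MvPowerSeries (Fin 3) k)) [hP : P.IsPrime]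
    (hdim : ringKrullDim (MvPowerSeries (Fin 3) k ⧸ P) = 1)
    (hmax : haveI := isLocalRing_quotient P; maximalIdeal (MvPowerSeries (Fin 3) k ⧸ P) = Ideal.span {Ideal.Quotient.mk P (X 0)}) :
    haveI := isDiscreteValuationRing_integralClosure P hdim
    IsDiscreteValuationRing.addVal (integralClosure (MvPowerSeries (Fin 3) k ⧸ P) (FractionRing (MvPowerSeries (Fin 3) k ⧸ P)))
      (algebraMap (MvPowerSeries (Fin 3) k ⧸ P) _ (Ideal.Quotient.mk P (X 0))) = 1 := by
  haveI := isLocalRing_quotient P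
  haveI := isNoetherianRing_quotient P
  haveI hW := isDiscreteValuationRing_integralClosure P hdim
  set D := MvPowerSeries (Fin 3) k ⧸ P
  -- `D` is a discrete valuation ring with uniformizer `ū₁`
  have hnf : ¬ IsField D := by
    intro hF
    have := ringKrullDim_eq_zero_of_isField hF
    rw [hdim] at this
    exact one_ne_zero this
  have hprinc : (maximalIdeal D).IsPrincipal := ⟨⟨Ideal.Quotient.mk P (X 0), by rw [hmax]⟩⟩
  haveI hD : IsDiscreteValuationRing D := ((IsDiscreteValuationRing.TFAE D hnf).out 0 4).mpr hprinc
  have hirr : Irreducible (Ideal.Quotient.mk P (X 0) : D) := (IsDiscreteValuationRing.irreducible_iff_uniformizer _).mpr hmax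
  -- `D → W` is bijective (`D` integrally closed)
  set W := integralClosure D (FractionRing D)
  have hbij : Function.Bijective (algebraMap D W) := by
    refine ⟨algebraMap_integralClosure_injective P, fun w => ?_⟩
    obtain ⟨y, hy⟩ := (IsIntegrallyClosed.isIntegral_iff (R := D) (K := FractionRing D)).mp w.2
    exact ⟨y, Subtype.ext hy⟩
  let e : D ≃+* W := RingEquiv.ofBijective (algebraMap D W) hbij
  have hirr' : Irreducible (algebraMap D W (Ideal.Quotient.mk P (X 0))) := by
    change Irreducible (e (Ideal.Quotient.mk P (X 0)))
    exact (MulEquiv.irreducible_iff e.toMulEquiv).mpr hirr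
  exact IsDiscreteValuationRing.addVal_uniformizer hirr'

/-! ## D5: the conflict branch -/

/-- **B5-D5 — A CONFLICT STATE HAS A CHARGED SMOOTH BRANCH TRANSVERSE TO `V(u₁)`**: under the context, `InPoly` and `Conflict`, some
non-line top-locus prime has `v_P(u₁) = 1` (the prime of the graph datum; `u₂ ∉ P` because the datum has `h ≠ 0` by well-prepared minimality). -/
theorem exists_transverse_of_conflict (p : ℕ) [Fact p.Prime] [CharP k p] [IsAlgClosed k] {d : ℕ} {A : Fin d → MvPowerSeries (Fin 2) k}
    {N : Finset (Fin 2)}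
    (hctx : ∃ (b : MvPowerSeries (Fin (2 + 1)) k) (δ : TameFourTupleDrop.Decoration k 2) (Θ : Fin (2 + 1) → MvPowerSeries (Fin (2 + 1)) k),
      TameFourTupleDrop.Admissible b δ ∧ 2 ≤ δ.o ∧ δ.c = d ∧ δ.PresBy d A N Θ)
    (hin : InPoly d A) (hconf : NCPoly.Conflict d A N) :
    ∃ P ∈ topPrimesNL d A, branchVal P (X 0) = 1 := by
  have hd2 : 2 ≤ d := NCBranchPrimes.two_le_of_presContext hctx
  have hsq : Squarefree (NCPoly.monicGerm d A) := NCBranchPrimes.squarefree_monicGerm_of_presContext hctx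
  obtain ⟨-, h2, ⟨h, ψ, hh, hψ, hperm⟩, -⟩ := hconf
  obtain ⟨P, hP, hX0, hlin, hF, hzero, hcong⟩ := exists_graphPrime A hh hψ hperm
  haveI := hP
  -- `h ≠ 0` (minimality), hence `u₂ ∉ P`
  have hh0 : h ≠ 0 := by
    rintro rfl
    rw [shearT_zero] at hperm
    exact h2 (isPermissibleTwoT_of_shift (by omega) hin.1 hin.2.1 hψ hperm)
  have hX1 : (X 1 : MvPowerSeries (Fin 3) k) ∉ P := by
    intro h1
    have h3 : (X 0 : MvPowerSeries (Fin 3) k) * toThree h ∈ P := by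
      have := Ideal.sub_mem P h1 hlin; rwa [sub_sub_cancel] at this
    have h4 : toThree h ∈ P := (hP.mem_or_mem h3).resolve_left hX0
    exact hh0 (hzero h hh h4)
  have hPm : P ≠ maximalIdeal (MvPowerSeries (Fin 3) k) := fun e => hX0 (e ▸ X_mem_maximalIdeal k (Fin 3) 0)
  have htop : P ∈ topPrimes d A := ⟨hP, hPm, 1, fun h1 => hP.ne_top ((Ideal.eq_top_iff_one P).mpr h1), by rwa [one_mul]⟩
  refine ⟨P, ⟨htop, hX0, hX1⟩, ?_⟩
  have hdim := ringKrullDim_eq_one_of_mem_topPrimes p hd2 hsq htop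
  rw [branchVal_eq_addVal p hd2 hsq htop]
  exact addVal_mk_X_zero_eq_one_of_principal P hdim (maximalIdeal_quotient_eq_span hcong)

end TOT2Branch

end Summit.ResolutionOfSingularities.ResolutionOfSingularities.Theorems

end
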